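import Summits.ResolutionOfSingularities.ResolutionOfSingularities.Theorems.FrobeniusLadderFInjectiveMacaulayficationOmegaOneS2PencilCharts
import Summits.ResolutionOfSingularities.ResolutionOfSingularities.Theorems.FrobeniusLadderFInjectiveMacaulayficationOmegaOneS2Tag4Side
import Summits.ResolutionOfSingularities.ResolutionOfSingularities.Theorems.FrobeniusLadderFInjectiveMacaulayficationChartPointSoundness
import Summits.ResolutionOfSingularities.ResolutionOfSingularities.Theorems.FrobeniusLadderFInjectiveMacaulayficationChartStalkPoint
import Summits.ResolutionOfSingularities.ResolutionOfSingularities.Theorems.FrobeniusLadderFInjectiveMacaulayficationBPBinomialTransversalFace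
import Summits.ResolutionOfSingularities.ResolutionOfSingularities.Theorems.FrobeniusLadderFInjectiveMacaulayficationPencilStalkOverPoint
import Summits.ResolutionOfSingularities.ResolutionOfSingularities.Theorems.FrobeniusLadderFInjectiveMacaulayficationPrincipalStalkPackage
import Summits.ResolutionOfSingularities.ResolutionOfSingularities.Theorems.FrobeniusLadderFInjectiveMacaulayficationNewtonChartLemmaWeak
import Summits.ResolutionOfSingularities.ResolutionOfSingularities.Theorems.FrobeniusLadderFInjectiveMacaulayficationB9PointFloorRowClass
import Summits.ResolutionOfSingularities.ResolutionOfSingularities.Theorems.FrobeniusLadderFInjectiveMacaulayficationClauseLocalizesScheme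
import Summits.ResolutionOfSingularities.ResolutionOfSingularities.Theorems.FrobeniusLadderFInjectiveMacaulayficationFTemkinClosedPoints
import HarnessLib

/-!
# ★★★ Ω₁ GLOBAL PATCH, F6: `Bl_{(L³+(ḡ)L²)·K″} X_{B9}` IS `FullCl p` AT EVERY POINT (all primes `p` with `2·3·31 ≠ 0`), by the direct Fedder argument over the regular refined class model `X̃₂`
# (BED Ω₁ GLOBAL PATCH, F6 v2 (D) assembly, part 2 = the row `hrow`; crux `FInjectiveMacaulayfication` stmt-ResolutionOfSingularities-15315, chain w45a; seat res-L1-w45a-stub-3 g15)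

[OURS · L1 W4.5a] Support file (`--supports stmt-ResolutionOfSingularities-15315 --as helper`); theorems only; assembly of ✓ bricks; no named fact; NOT a statement of any manuscript; nothing of the
crux is proved (this is the FULL input `hrow` of the Ω₁ row via ✓ `FHalfRowOfProductCentre.fHalfConclusion_of_affineBlowup_mul`). AI-written (AI review is weaker than expert review).

`f = X₄² + X₀⁹ + X₁⁹ + X₂⁹ + X₃⁹`, `k` algebraically closed of characteristic `p`, `2·3·31 ≠ 0` in `k`; `L = (x^e : e ∈ genSet 5 B9NewtonKFan.AL2)` (the class centre `𝔪·K`), `ḡ = X₀X₂² − X₁³`,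
`K″ = (x^e : e ∈ genSet 5 AL2)` (global cure fan Σ₂). For `y ∈ S″ = Bl_{(L³+(ḡ)L²)K″} X` CLOSED, `x̃ = τ₂ y ∈ X̃₂` lies in a vertex chart `U_c ≅ Spec k[y]/(g_c)` at a `k`-point `c`, orbit `Z`;
the centre reads `Φ⁻¹ȳ^G·(Φ⁻¹ȳ^{M₁}, Φ⁻¹ȳ^{M₂}(ȳ^r − ȳ^s))` (✓ `OmegaOneS2PencilCharts.ideal_centre_chart_eq`); the recorded exit tag of `(c, Z)` (✓ `ExitTagSemantics.tag_S2_spec`, ✓ `cert_S2_exits`)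
is `0` (`u` a unit at `x̃`: principal branch ✓ `PrincipalStalkPackage.fullCl_stalk_of_pair_unit` + class row ✓ `OmegaOneS2ClassRow.affineBlowup_K2_fullCl_b9`), `1–5` (✓ `ChartPointSoundness.tag_soundness`
on the stalk `𝒪_{X̃₂,x̃}` — regular by Ishii's lemma ✓ `ishii_lemma_4_4_24_weak`, T1 transversality ✓ `b9_exists_minor_ne_zero_of_ne31` — then ✓ `PencilStalkOverPoint.fullCl_stalk_of_pair_germ_over`), never `9`
(✓ `eval_strictTransform_ne_zero_of_tag9`). Non-closed points by ✓ `ClauseLocalizesScheme.fiClause_of_closedPoints`.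
* ★★★ `fullCl_stalk_cure_b9_of_isClosed`, ★★★ `fullCl_stalk_cure_b9` — `∀ y : Bl_{(L³+(ḡ)L²)·K″} X, FullCl p 𝒪_{S″,y}`; ★★★ `omega1_floor_cured_b9` — the F7 line: the F-half's conclusion for the Ω₁ floor at every `v ∈ V(K″)`.
[cite: Fedder1983, Thm. 1.12; IshiiSingularities2018, Lemma 4.4.24; StacksProject, Tag 0804, Tag 080A; Matsumura1987, Thm. 14.2, Thm. 17.4]
-/

set_option linter.dupNamespace false
set_option linter.style.longLine false

noncomputable section

namespace Summit.ResolutionOfSingularities.ResolutionOfSingularities.Theorems.FInjectiveMacaulayfication.OmegaOneS2PencilRow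

open AlgebraicGeometry CategoryTheory MvPolynomial IsLocalRing Literature.AlgebraicGeometry.Resolution
open Summit.ResolutionOfSingularities.ResolutionOfSingularities.Theorems.FInjectiveMacaulayfication
open SliceableCentre FanCheckKit FanCheckSound OmegaOneCureFanCert OmegaOneGlobalCureFanCert OmegaOneS2KNewtonKFan OmegaOneS2ChartData OmegaOneS2PencilCharts OmegaOneS2Tag4Side

set_option maxHeartbeats 3200000 in
-- one long assembly: chart package, stalk package, exponent bookkeeping, tag dispatch
/-- ★★★ **THE Ω₁ ROW INPUT AT CLOSED POINTS**: every CLOSED point of `S″ = Bl_{(L³+(ḡ)L²)·K″} X_{B9}` has a `FullCl p` stalk (`k = k̄`, `2·3·31 ≠ 0`). [OURS · F6 assembly] -/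
theorem fullCl_stalk_cure_b9_of_isClosed (p : ℕ) [Fact p.Prime] (k : Type) [Field k] [IsAlgClosed k] [CharP k p] (h2 : (2 : k) ≠ 0) (h3 : (3 : k) ≠ 0) (h31 : (31 : k) ≠ 0)
    (f : MvPolynomial (Fin 5) k) (hf : f = X 4 ^ 2 + X 0 ^ 9 + X 1 ^ 9 + X 2 ^ 9 + X 3 ^ 9) :
    ∀ y : ↥(affineBlowup ((Ideal.span ((fun e : Fin 5 →₀ ℕ => Ideal.Quotient.mk (Ideal.span {f}) (monomial e (1 : k))) '' (genSet 5 B9NewtonKFan.AL2 : Set (Fin 5 →₀ ℕ))) ^ 3 + Ideal.span {Ideal.Quotient.mk (Ideal.span {f}) (X 0 * X 2 ^ 2 - X 1 ^ 3)} * Ideal.span ((fun e : Fin 5 →₀ ℕ => Ideal.Quotient.mk (Ideal.span {f}) (monomial e (1 : k))) '' (genSet 5 B9NewtonKFan.AL2 : Set (Fin 5 →₀ ℕ))) ^ 2) * Ideal.span ((fun e : Fin 5 →₀ ℕ => Ideal.Quotient.mk (Ideal.span {f}) (monomial e (1 : k))) '' (genSet 5 AL2 : Set (Fin 5 →₀ ℕ))))),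 IsClosed ({y} : Set ↥(affineBlowup ((Ideal.span ((fun e : Fin 5 →₀ ℕ => Ideal.Quotient.mk (Ideal.span {f}) (monomial e (1 : k))) '' (genSet 5 B9NewtonKFan.AL2 : Set (Fin 5 →₀ ℕ))) ^ 3 + Ideal.span {Ideal.Quotient.mk (Ideal.span {f}) (X 0 * X 2 ^ 2 - X 1 ^ 3)} * Ideal.span ((fun e : Fin 5 →₀ ℕ => Ideal.Quotient.mk (Ideal.span {f}) (monomial e (1 : k))) '' (genSet 5 B9NewtonKFan.AL2 : Set (Fin 5 →₀ ℕ))) ^ 2) * Ideal.span ((fun e : Fin 5 →₀ ℕ => Ideal.Quotient.mk (Ideal.span {f}) (monomial e (1 : k))) '' (genSet 5 AL2 : Set (Fin 5 →₀ ℕ)))))) → FullCl p ((affineBlowup ((Ideal.span ((fun e : Fin 5 →₀ ℕ => Ideal.Quotient.mk (Ideal.span {f}) (monomial e (1 : k))) '' (genSet 5 B9NewtonKFan.AL2 : Set (Fin 5 →₀ ℕ))) ^ 3 + Ideal.span {Ideal.Quotient.mk (Ideal.span {f}) (X 0 * X 2 ^ 2 - X 1 ^ 3)} * Ideal.span ((fun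 e : Fin 5 →₀ ℕ => Ideal.Quotient.mk (Ideal.span {f}) (monomial e (1 : k))) '' (genSet 5 B9NewtonKFan.AL2 : Set (Fin 5 →₀ ℕ))) ^ 2) * Ideal.span ((fun e : Fin 5 →₀ ℕ => Ideal.Quotient.mk (Ideal.span {f}) (monomial e (1 : k))) '' (genSet 5 AL2 : Set (Fin 5 →₀ ℕ))))).presheaf.stalk y) := by
  classical
  haveI hpr : (Ideal.span {f}).IsPrime := (Ideal.span_singleton_prime (B9Specimen.prime_f k h3 f hf).ne_zero).mpr (B9Specimen.prime_f k h3 f hf)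
  haveI : IsDomain (MvPolynomial (Fin 5) k ⧸ Ideal.span {f}) := Ideal.Quotient.isDomain _
  haveI : IsIntegral (affineBlowup (Ideal.span ((fun e : Fin 5 →₀ ℕ => Ideal.Quotient.mk (Ideal.span {f}) (monomial e (1 : k))) '' (genSet 5 AL2 : Set (Fin 5 →₀ ℕ))))) := isIntegral_K2 k h3 f hf
  -- ### the cure morphism
  obtain ⟨τ, hτ, hfac⟩ := exists_tau2 k h3 f hf (Ideal.Quotient.mk (Ideal.span {f}) (X 0 * X 2 ^ 2 - X 1 ^ 3))
  haveI : UniversallyClosed (τ ≫ affineBlowup.π (Ideal.span ((fun e : Fin 5 →₀ ℕ => Ideal.Quotient.mk (Ideal.span {f}) (monomial e (1 : k))) '' (genSet 5 AL2 : Set (Fin 5 →₀ ℕ))))) := by rw [hfac]; infer_instance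
  haveI : UniversallyClosed τ := UniversallyClosed.of_comp_of_isSeparated τ (affineBlowup.π (Ideal.span ((fun e : Fin 5 →₀ ℕ => Ideal.Quotient.mk (Ideal.span {f}) (monomial e (1 : k))) '' (genSet 5 AL2 : Set (Fin 5 →₀ ℕ)))))
  intro y hyc
  -- `x̃ = τ y` is a closed point
  have hxc : IsClosed ({τ.base y} : Set ↥(affineBlowup (Ideal.span ((fun e : Fin 5 →₀ ℕ => Ideal.Quotient.mk (Ideal.span {f}) (monomial e (1 : k))) '' (genSet 5 AL2 : Set (Fin 5 →₀ ℕ)))))) := by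
    have := τ.isClosedMap _ hyc
    rwa [Set.image_singleton] at this
  -- ### the chart of `x̃`
  obtain ⟨c, hc⟩ := MonomialChartSections.exists_mem_chartOpen (fun c : Fin 1223 => Ideal.Quotient.mk (Ideal.span {f}) (monomial (chartM 5 AL2 CL 1223 c) (1 : k)))
    (hv k (Ideal.span {f})) (irrelevant_le_radical_K2 k _) (τ.base y)
  obtain ⟨g, hg0, hcop, hθ, Φ, hΦ⟩ := exists_chart_package k h3 f hf c
  haveI : IsDomain Γ(affineBlowup (Ideal.span ((fun e : Fin 5 →₀ ℕ => Ideal.Quotient.mk (Ideal.span {f}) (monomial e (1 : k))) '' (genSet 5 AL2 : Set (Fin 5 →₀ ℕ)))), (affineBlowup.chartOpen (Ideal.Quotient.mk (Ideal.span {f}) (monomial (chartM 5 AL2 CL 1223 c) (1 : k))) (hv k _ c) : (affineBlowup (Ideal.span ((fun e : Fin 5 →₀ ℕ => Ideal.Quotient.mk (Ideal.span {f}) (monomial e (1 : k))) '' (genSet 5 AL2 : Set (Fin 5 →₀ ℕ))))).Opens)) := @IsIntegral.component_integral _ inferInstance _ ⟨⟨τ.base y, hc⟩⟩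
  have hgunit : ¬ IsUnit g := by
    intro hu
    haveI : Nontrivial (MvPolynomial (Fin 5) k ⧸ Ideal.span {g}) := Φ.symm.toRingHom.domain_nontrivial
    exact (Ideal.Quotient.nontrivial_iff.mp ‹_›) ((Ideal.span_singleton_eq_top).mpr hu)
  have hgne : g ≠ 0 := fun h0 => hg0 (by rw [h0, map_zero])
  -- ### the stalk of `X̃₂` at `x̃` as the abstract local ring `B ← k[y]`
  obtain ⟨cpt, hθc, hφθ, hφ, hdim, hres, hreg⟩ := ChartStalkPoint.exists_closedPoint_package (n := 5) (by norm_num) g hgne (affineBlowup.chartOpen (Ideal.Quotient.mk (Ideal.span {f}) (monomial (chartM 5 AL2 CL 1223 c) (1 : k))) (hv k _ c)).2 Φ (τ.base y) hc hxc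
  haveI : IsAlgClosed (ResidueField ((affineBlowup (Ideal.span ((fun e : Fin 5 →₀ ℕ => Ideal.Quotient.mk (Ideal.span {f}) (monomial e (1 : k))) '' (genSet 5 AL2 : Set (Fin 5 →₀ ℕ))))).presheaf.stalk (τ.base y))) := hres
  haveI : CharP ((affineBlowup (Ideal.span ((fun e : Fin 5 →₀ ℕ => Ideal.Quotient.mk (Ideal.span {f}) (monomial e (1 : k))) '' (genSet 5 AL2 : Set (Fin 5 →₀ ℕ))))).presheaf.stalk (τ.base y)) p :=
    FTemkinClosedPoints.charP_stalk_of_over p (Spec.map (CommRingCat.ofHom (algebraMap k (MvPolynomial (Fin 5) k ⧸ Ideal.span {f})))) (affineBlowup.π (Ideal.span ((fun e : Fin 5 →₀ ℕ => Ideal.Quotient.mk (Ideal.span {f}) (monomial e (1 : k))) '' (genSet 5 AL2 : Set (Fin 5 →₀ ℕ))))) (τ.base y)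
  -- the orbit of `x̃`
  obtain ⟨Z, hZdef⟩ : ∃ Z : Finset (Fin 5), Z = Finset.univ.filter fun i => cpt i = 0 := ⟨_, rfl⟩
  have hZ : ∀ i : Fin 5, cpt i = 0 ↔ i ∈ Z := fun i => by simp [hZdef]
  -- ### exponent bookkeeping on the chart
  have hCWlen : (getL CWS_S2 (getL PARENT_S2 c 0) []).length = 5 := (parent_lt c).2
  have hbLcoe := coe_chartM_parent c
  obtain ⟨Cv, hCv⟩ : ∃ Cv : Fin 5 → ℕ, Cv = (Vq c).mulVec (vecOf 5 (getL CWS_S2 (getL PARENT_S2 c 0) [])) := ⟨_, rfl⟩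
  obtain ⟨Av, hAv⟩ : ∃ Av : Fin 5 → ℕ, Av = (Vq c).mulVec (vecOf 5 [1, 0, 2, 0, 0]) := ⟨_, rfl⟩
  obtain ⟨Bv, hBv⟩ : ∃ Bv : Fin 5 → ℕ, Bv = (Vq c).mulVec (vecOf 5 [0, 3, 0, 0, 0]) := ⟨_, rfl⟩
  obtain ⟨G, hG⟩ : ∃ G : Fin 5 →₀ ℕ, ∀ i, G i = min (Cv i) (min (Av i) (Bv i)) := ⟨Finsupp.equivFunOnFinite.symm fun i => min (Cv i) (min (Av i) (Bv i)), fun i => by simp⟩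
  obtain ⟨M1, hM1⟩ : ∃ M1 : Fin 5 →₀ ℕ, ∀ i, M1 i = Cv i - min (Cv i) (min (Av i) (Bv i)) := ⟨Finsupp.equivFunOnFinite.symm fun i => Cv i - min (Cv i) (min (Av i) (Bv i)), fun i => by simp⟩
  obtain ⟨M2, hM2⟩ : ∃ M2 : Fin 5 →₀ ℕ, ∀ i, M2 i = min (Av i) (Bv i) - min (Cv i) (min (Av i) (Bv i)) :=
    ⟨Finsupp.equivFunOnFinite.symm fun i => min (Av i) (Bv i) - min (Cv i) (min (Av i) (Bv i)), fun i => by simp⟩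
  obtain ⟨r, hr⟩ : ∃ r : Fin 5 →₀ ℕ, ∀ i, r i = Av i - min (Av i) (Bv i) := ⟨Finsupp.equivFunOnFinite.symm fun i => Av i - min (Av i) (Bv i), fun i => by simp⟩
  obtain ⟨sx, hs⟩ : ∃ sx : Fin 5 →₀ ℕ, ∀ i, sx i = Bv i - min (Av i) (Bv i) := ⟨Finsupp.equivFunOnFinite.symm fun i => Bv i - min (Av i) (Bv i), fun i => by simp⟩
  obtain ⟨mm, hmm⟩ : ∃ mm : Fin 5 →₀ ℕ, ∀ i, mm i = min (Av i) (Bv i) := ⟨Finsupp.equivFunOnFinite.symm fun i => min (Av i) (Bv i), fun i => by simp⟩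
  have hminle : ∀ i, min (Cv i) (min (Av i) (Bv i)) ≤ Cv i ∧ min (Cv i) (min (Av i) (Bv i)) ≤ min (Av i) (Bv i) ∧ min (Av i) (Bv i) ≤ Av i ∧ min (Av i) (Bv i) ≤ Bv i :=
    fun i => ⟨min_le_left _ _, min_le_right _ _, min_le_left _ _, min_le_right _ _⟩
  have hMdisj : ∀ i, M1 i = 0 ∨ M2 i = 0 := fun i => by
    rw [hM1, hM2]
    rcases le_total (Cv i) (min (Av i) (Bv i)) with h | h
    · left; rw [min_eq_left h]; omega
    · right; rw [min_eq_right h]; omega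
  have hrsdisj : ∀ i, r i = 0 ∨ sx i = 0 := fun i => by
    rw [hr, hs]
    rcases le_total (Av i) (Bv i) with h | h
    · left; rw [min_eq_left h]; omega
    · right; rw [min_eq_right h]; omega
  have hVb : (Vq c).mulVec ⇑(chartM 5 B9NewtonKFan.AL2 B9NewtonKFan.CL 25 ⟨getL PARENT_S2 c 0, (parent_lt c).1⟩) = Cv := by rw [hbLcoe, hCv]
  have hC : (Finsupp.equivFunOnFinite.symm ((Vq c).mulVec ⇑(chartM 5 B9NewtonKFan.AL2 B9NewtonKFan.CL 25 ⟨getL PARENT_S2 c 0, (parent_lt c).1⟩)) : Fin 5 →₀ ℕ) = G + M1 := by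
    ext i
    rw [Finsupp.add_apply, hG, hM1, Finsupp.coe_equivFunOnFinite_symm, hVb]
    have := (hminle i).1
    omega
  have hχg₀ : aeval (fun j : Fin 5 => ∏ i : Fin 5, (X i : MvPolynomial (Fin 5) k) ^ Vq c i j) (X 0 * X 2 ^ 2 - X 1 ^ 3 : MvPolynomial (Fin 5) k) =
      monomial G (1 : k) * (monomial M2 (1 : k) * (monomial r 1 - monomial sx 1)) := by
    rw [aeval_g0_eq]
    refine binomial_eq_of_exponents _ _ G M2 r sx (fun i => ?_) (fun i => ?_)
    · rw [hG, hM2, hr, Finsupp.coe_equivFunOnFinite_symm, ← hAv]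
      have := (hminle i).2.1; have := (hminle i).2.2.1
      omega
    · rw [hG, hM2, hs, Finsupp.coe_equivFunOnFinite_symm, ← hBv]
      have := (hminle i).2.1; have := (hminle i).2.2.2
      omega
  -- ### the centre on the chart: `𝒥(U_c) = (γu, γv)`
  have h𝒥 := ideal_centre_chart_eq f (Vq c) (chartM 5 AL2 CL 1223 c) (genSet 5 AL2) g (hv k _ c) Φ hΦ (genSet 5 B9NewtonKFan.AL2)
      (chartM 5 B9NewtonKFan.AL2 B9NewtonKFan.CL 25 ⟨getL PARENT_S2 c 0, (parent_lt c).1⟩) (B9NewtonKFan.hm _) (hgeB c)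
      (X 0 * X 2 ^ 2 - X 1 ^ 3) G M1 (monomial M2 (1 : k) * (monomial r 1 - monomial sx 1)) hχg₀ hC
  have hγ0 : Φ.symm (Ideal.Quotient.mk (Ideal.span {g}) (monomial G 1)) ≠ 0 := by
    intro h0
    have h1 : Ideal.Quotient.mk (Ideal.span {g}) (monomial G (1 : k)) = 0 := by rw [← Φ.apply_symm_apply (Ideal.Quotient.mk _ _), h0, map_zero]
    rw [Ideal.Quotient.eq_zero_iff_mem, Ideal.mem_span_singleton] at h1
    exact ChartPrincipalIdeal.not_dvd_monomial_of_constantCoeff_ne_zero hg0 hgunit G h1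
  have hγ : Φ.symm (Ideal.Quotient.mk (Ideal.span {g}) (monomial G 1)) ∈ nonZeroDivisors Γ(affineBlowup (Ideal.span ((fun e : Fin 5 →₀ ℕ => Ideal.Quotient.mk (Ideal.span {f}) (monomial e (1 : k))) '' (genSet 5 AL2 : Set (Fin 5 →₀ ℕ)))), (affineBlowup.chartOpen (Ideal.Quotient.mk (Ideal.span {f}) (monomial (chartM 5 AL2 CL 1223 c) (1 : k))) (hv k _ c) : (affineBlowup (Ideal.span ((fun e : Fin 5 →₀ ℕ => Ideal.Quotient.mk (Ideal.span {f}) (monomial e (1 : k))) '' (genSet 5 AL2 : Set (Fin 5 →₀ ℕ))))).Opens)) := mem_nonZeroDivisors_of_ne_zero hγ0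
  -- the germs of `u, v` at `x̃`
  have huB : ((affineBlowup (Ideal.span ((fun e : Fin 5 →₀ ℕ => Ideal.Quotient.mk (Ideal.span {f}) (monomial e (1 : k))) '' (genSet 5 AL2 : Set (Fin 5 →₀ ℕ))))).presheaf.germ (affineBlowup.chartOpen (Ideal.Quotient.mk (Ideal.span {f}) (monomial (chartM 5 AL2 CL 1223 c) (1 : k))) (hv k _ c)) (τ.base y) hc).hom (Φ.symm (Ideal.Quotient.mk (Ideal.span {g}) (monomial M1 1))) =
      (((affineBlowup (Ideal.span ((fun e : Fin 5 →₀ ℕ => Ideal.Quotient.mk (Ideal.span {f}) (monomial e (1 : k))) '' (genSet 5 AL2 : Set (Fin 5 →₀ ℕ))))).presheaf.germ (affineBlowup.chartOpen (Ideal.Quotient.mk (Ideal.span {f}) (monomial (chartM 5 AL2 CL 1223 c) (1 : k))) (hv k _ c)) (τ.base y) hc).hom.comp (Φ.symm.toRingHom.comp (Ideal.Quotient.mk (Ideal.span {g})))) (monomial M1 1) := rfl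
  have hvB : ((affineBlowup (Ideal.span ((fun e : Fin 5 →₀ ℕ => Ideal.Quotient.mk (Ideal.span {f}) (monomial e (1 : k))) '' (genSet 5 AL2 : Set (Fin 5 →₀ ℕ))))).presheaf.germ (affineBlowup.chartOpen (Ideal.Quotient.mk (Ideal.span {f}) (monomial (chartM 5 AL2 CL 1223 c) (1 : k))) (hv k _ c)) (τ.base y) hc).hom (Φ.symm (Ideal.Quotient.mk (Ideal.span {g}) (monomial M2 (1 : k) * (monomial r 1 - monomial sx 1)))) =
      (((affineBlowup (Ideal.span ((fun e : Fin 5 →₀ ℕ => Ideal.Quotient.mk (Ideal.span {f}) (monomial e (1 : k))) '' (genSet 5 AL2 : Set (Fin 5 →₀ ℕ))))).presheaf.germ (affineBlowup.chartOpen (Ideal.Quotient.mk (Ideal.span {f}) (monomial (chartM 5 AL2 CL 1223 c) (1 : k))) (hv k _ c)) (τ.base y) hc).hom.comp (Φ.symm.toRingHom.comp (Ideal.Quotient.mk (Ideal.span {g})))) (monomial M2 1 * (monomial r 1 - monomial sx 1)) := rfl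
  -- `X̃₂` is FULL at `x̃` (class row)
  have hX : FullCl p ((affineBlowup (Ideal.span ((fun e : Fin 5 →₀ ℕ => Ideal.Quotient.mk (Ideal.span {f}) (monomial e (1 : k))) '' (genSet 5 AL2 : Set (Fin 5 →₀ ℕ))))).presheaf.stalk (τ.base y)) := (OmegaOneS2ClassRow.affineBlowup_K2_fullCl_b9 p k h2 h3 f hf).1 (τ.base y)
  -- ### dispatch: principal orbit (`M₁|Z = 0`)
  by_cases hM1Z : ∀ i ∈ Z, M1 i = 0
  · have hunit : IsUnit (((affineBlowup (Ideal.span ((fun e : Fin 5 →₀ ℕ => Ideal.Quotient.mk (Ideal.span {f}) (monomial e (1 : k))) '' (genSet 5 AL2 : Set (Fin 5 →₀ ℕ))))).presheaf.germ (affineBlowup.chartOpen (Ideal.Quotient.mk (Ideal.span {f}) (monomial (chartM 5 AL2 CL 1223 c) (1 : k))) (hv k _ c)) (τ.base y) hc).hom (Φ.symm (Ideal.Quotient.mk (Ideal.span {g}) (monomial M1 1)))) := by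
      rw [huB]; exact ChartPointSoundness.isUnit_map_monomial cpt _ hφ Z hZ M1 hM1Z
    exact PrincipalStalkPackage.fullCl_stalk_of_pair_unit p hτ _ _ _ _ h𝒥 hγ y (PrincipalStalkPackage.mem_basicOpen_of_isUnit_germ _ _ (τ.base y) hc hunit) hX
  -- ### non-principal orbit: the recorded exit tag
  push Not at hM1Z
  obtain ⟨i₀, hi₀Z, hi₀⟩ := hM1Z
  have ha : ∃ i ∈ Z, M1 i ≠ 0 := ⟨i₀, hi₀Z, hi₀⟩
  obtain ⟨zi, hzi⟩ := ExitTagSemantics.exists_orb_index Z ⟨i₀, hi₀Z⟩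
  have hy' : ∀ i : Fin 5, cpt i = 0 ↔ (i : ℕ) ∈ getL ORB5 zi [] := fun i => (hZ i).trans (hzi i)
  -- the strict transform at `cpt` vanishes: the tag is not `9`
  obtain ⟨aexp, haexp⟩ : ∃ aexp : Fin 5 → (Fin 5 →₀ ℕ), aexp = fun j => Finsupp.equivFunOnFinite.symm fun i => Vq c i j * (![9, 9, 9, 9, 2] : Fin 5 → ℕ) j - ∑ l, Vq c i l * U0 c l := ⟨_, rfl⟩
  have hgsum : g = ∑ j : Fin 5, monomial (aexp j) (1 : k) := by
    rw [haexp]; exact strictTransform_eq_sum k c g (by subst hf; exact hθ)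
  rcases ExitTagSemantics.tag_S2_spec c zi with ⟨-, hok⟩ | ⟨-, h9⟩
  swap
  · exfalso
    have h := eval_strictTransform_ne_zero_of_tag9 (k := k) c zi h9 cpt hy'
    rw [← strictTransform_eq_sum k c g (by subst hf; exact hθ)] at h
    exact h hθc
  -- the semantic content of the tag
  have hsem := ExitTagSemantics.exitOKW'_sound 5 (getL CWS_S2 (getL PARENT_S2 c 0) []) [1, 0, 2, 0, 0] [0, 3, 0, 0, 0] (raysOf RAYS_S2 (getL CONES_S2 c [])) (getL ORB5 zi []) _ hok
  dsimp only at hsem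
  -- dictionary between the list functions and the exponents
  have dC : ∀ i : Fin 5, dotL (getL (raysOf RAYS_S2 (getL CONES_S2 c [])) i []) (getL CWS_S2 (getL PARENT_S2 c 0) []) = Cv i := fun i => by rw [hCv]; exact dotL_rows_eq c _ hCWlen i
  have dA : ∀ i : Fin 5, dotL (getL (raysOf RAYS_S2 (getL CONES_S2 c [])) i []) [1, 0, 2, 0, 0] = Av i := fun i => by rw [hAv]; exact dotL_rows_eq c _ rfl i
  have dB : ∀ i : Fin 5, dotL (getL (raysOf RAYS_S2 (getL CONES_S2 c [])) i []) [0, 3, 0, 0, 0] = Bv i := fun i => by rw [hBv]; exact dotL_rows_eq c _ rfl i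
  -- transport of `∀ i ∈ orbit-list` / `∃ i ∈ orbit-list` statements to `Z`
  have toZ : ∀ (P : ℕ → Prop), (∀ i ∈ getL ORB5 (zi : ℕ) [], P i) → ∀ i : Fin 5, i ∈ Z → P i := fun P h i hi => h i ((hzi i).mp hi)
  have toZ' : ∀ (P : ℕ → Prop), (∃ i ∈ getL ORB5 (zi : ℕ) [], P i) → ∃ i : Fin 5, i ∈ Z ∧ P i := fun P ⟨i, hi, hP⟩ =>
    ⟨⟨i, ExitTagSemantics.orb_lt zi i hi⟩, (hzi ⟨i, _⟩).mpr hi, hP⟩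
  -- ### the Ishii letter (the orbit lies over the origin since `M₁|Z ≠ 0`)
  have hCpos : 0 < Cv i₀ := Nat.pos_of_ne_zero fun h0 => hi₀ (by rw [hM1, h0, Nat.zero_sub])
  have hpos := hpos_of_order_pos c Z i₀ hi₀Z (by rw [← hCv]; exact hCpos)
  obtain ⟨l, hlZ, hl⟩ := NewtonChartLemma.ishii_lemma_4_4_24_weak f (B9PointFloorRowClass.weaklyNondegenerate_b9 k h3 f hf) (Vq c) (hV c) _ g hθ hg0 Z hpos cpt hZ hθc
  haveI hregB : IsRegularLocalRing ((affineBlowup (Ideal.span ((fun e : Fin 5 →₀ ℕ => Ideal.Quotient.mk (Ideal.span {f}) (monomial e (1 : k))) '' (genSet 5 AL2 : Set (Fin 5 →₀ ℕ))))).presheaf.stalk (τ.base y)) := hreg l hl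
  -- ### the T1 transversality provider (B9 special face needs `31 ≠ 0`)
  have hvecP : ∀ j : Fin 5, vecOf 5 [1, 0, 2, 0, 0] j = (![1, 0, 2, 0, 0] : Fin 5 → ℕ) j := fun j => by fin_cases j <;> rfl
  have hvecQ : ∀ j : Fin 5, vecOf 5 [0, 3, 0, 0, 0] j = (![0, 3, 0, 0, 0] : Fin 5 → ℕ) j := fun j => by fin_cases j <;> rfl
  have hminor : (∀ i ∈ Z, r i = 0) → (∀ i ∈ Z, sx i = 0) → eval cpt (monomial r (1 : k) - monomial sx 1) = 0 →
      (∃ i, i ∉ Z ∧ (r i : k) ≠ (sx i : k)) →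
      ∃ l i₀, l ∉ Z ∧ i₀ ∉ Z ∧ l ≠ i₀ ∧ eval cpt (pderiv l g) ≠ 0 ∧
        eval cpt (pderiv l g) * eval cpt (pderiv i₀ (monomial r (1 : k) - monomial sx 1)) - eval cpt (pderiv i₀ g) * eval cpt (pderiv l (monomial r (1 : k) - monomial sx 1)) ≠ 0 := by
    intro hr0 hs0 hw0 hnp
    rw [hgsum]
    refine BPBinomialTransversal.b9_exists_minor_ne_zero_of_ne31 h2 h3 h31 (Vq c) (hV c) (fun i => ∑ l, Vq c i l * U0 c l) aexp (fun j i => ?_) mm r sx (fun i => ?_) (fun i => ?_) Z cpt hZ hr0 hs0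
      (by rw [← hgsum]; exact hθc) hw0 hnp ⟨l, hlZ, by rw [← hgsum]; exact hl⟩
    · rw [haexp]; simp only [Finsupp.coe_equivFunOnFinite_symm]
      have := d_le k c i j; omega
    · rw [hr, hmm]
      have hA' : Av i = ∑ j, Vq c i j * (![1, 0, 2, 0, 0] : Fin 5 → ℕ) j := by
        rw [hAv]; simp only [Matrix.mulVec, dotProduct]; exact Finset.sum_congr rfl fun j _ => by rw [hvecP]
      have := (hminle i).2.2.1; omega
    · rw [hs, hmm]
      have hB' : Bv i = ∑ j, Vq c i j * (![0, 3, 0, 0, 0] : Fin 5 → ℕ) j := by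
        rw [hBv]; simp only [Matrix.mulVec, dotProduct]; exact Finset.sum_congr rfl fun j _ => by rw [hvecQ]
      have := (hminle i).2.2.2; omega
  -- ### the tag conditions ⇒ `tag_soundness`
  have main : ∀ (hnp : (∀ i ∈ Z, r i = 0) → (∀ i ∈ Z, sx i = 0) → ∃ i, i ∉ Z ∧ (r i : k) ≠ (sx i : k))
      (htag : (¬ ((∃ i ∈ Z, r i ≠ 0) ∧ (∃ i ∈ Z, sx i ≠ 0)) ∧
          ((∀ i ∈ Z, M2 i ≤ 1) ∨ (∀ i ∈ Z, M1 i ≤ 1) ∨ ((∀ i ∈ Z, M1 i ≤ 2) ∧ (∀ i ∈ Z, M2 i ≤ 2) ∧ p ≠ 2))) ∨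
        (((∃ i ∈ Z, r i ≠ 0) ∧ (∃ i ∈ Z, sx i ≠ 0)) ∧
          (((∀ i ∈ Z, M1 i ≤ 1) ∧ (∃ i ∈ Z, M2 i + r i ≠ 0 ∧ M1 i = 0) ∧ (∃ i ∈ Z, M2 i + sx i ≠ 0 ∧ M1 i = 0)) ∨
            ((∀ i ∈ Z, M2 i + r i ≤ 1) ∧ (∃ i ∈ Z, M1 i ≠ 0 ∧ r i = 0))))),
      FullCl p ((affineBlowup ((Ideal.span ((fun e : Fin 5 →₀ ℕ => Ideal.Quotient.mk (Ideal.span {f}) (monomial e (1 : k))) '' (genSet 5 B9NewtonKFan.AL2 : Set (Fin 5 →₀ ℕ))) ^ 3 + Ideal.span {Ideal.Quotient.mk (Ideal.span {f}) (X 0 * X 2 ^ 2 - X 1 ^ 3)} * Ideal.span ((fun e : Fin 5 →₀ ℕ => Ideal.Quotient.mk (Ideal.span {f}) (monomial e (1 : k))) '' (genSet 5 B9NewtonKFan.AL2 : Set (Fin 5 →₀ ℕ))) ^ 2) * Ideal.span ((fun e : Fin 5 →₀ ℕ => Ideal.Quotient.mk (Ideal.span {f}) (monomial e (1 : k))) ''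 (genSet 5 AL2 : Set (Fin 5 →₀ ℕ))))).presheaf.stalk y) := by
    intro hnp htag
    rcases ChartPointSoundness.tag_soundness g cpt p _ hφθ hφ Z hZ hdim hθc M1 M2 r sx hMdisj hrsdisj ha _ _ huB hvB ⟨l, hlZ, hl⟩
        (fun hr0 hs0 hw0 => hminor hr0 hs0 hw0 (hnp hr0 hs0)) htag with hvu | ⟨hu1, hu2, hv1, hv2, hW, hU⟩
    · -- `v` is a unit at `x̃`: principal branch with the roles swapped
      rw [Set.pair_comm] at h𝒥
      exact PrincipalStalkPackage.fullCl_stalk_of_pair_unit p hτ _ _ _ _ h𝒥 hγ y (PrincipalStalkPackage.mem_basicOpen_of_isUnit_germ _ _ (τ.base y) hc hvu) hX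
    · exact PencilStalkOverPoint.fullCl_stalk_of_pair_germ_over p hτ _ _ _ _ h𝒥 hγ y hc hu1 hu2 hv1 hv2 hW hU
  have hp2 : p ≠ 2 := by rintro rfl; exact h2 (by exact_mod_cast CharP.cast_eq_zero k 2)
  -- ### read the tag
  have hT1np : (∃ i, i < 5 ∧ i ∉ getL ORB5 (zi : ℕ) [] ∧
        1 ≤ dotL (getL (raysOf RAYS_S2 (getL CONES_S2 ↑c [])) i []) [1, 0, 2, 0, 0] - min (dotL (getL (raysOf RAYS_S2 (getL CONES_S2 ↑c [])) i []) [1, 0, 2, 0, 0]) (dotL (getL (raysOf RAYS_S2 (getL CONES_S2 ↑c [])) i []) [0, 3, 0, 0, 0]) -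
              (dotL (getL (raysOf RAYS_S2 (getL CONES_S2 ↑c [])) i []) [0, 3, 0, 0, 0] - min (dotL (getL (raysOf RAYS_S2 (getL CONES_S2 ↑c [])) i []) [1, 0, 2, 0, 0]) (dotL (getL (raysOf RAYS_S2 (getL CONES_S2 ↑c [])) i []) [0, 3, 0, 0, 0])) +
            (dotL (getL (raysOf RAYS_S2 (getL CONES_S2 ↑c [])) i []) [0, 3, 0, 0, 0] - min (dotL (getL (raysOf RAYS_S2 (getL CONES_S2 ↑c [])) i []) [1, 0, 2, 0, 0]) (dotL (getL (raysOf RAYS_S2 (getL CONES_S2 ↑c [])) i []) [0, 3, 0, 0, 0]) -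
              (dotL (getL (raysOf RAYS_S2 (getL CONES_S2 ↑c [])) i []) [1, 0, 2, 0, 0] - min (dotL (getL (raysOf RAYS_S2 (getL CONES_S2 ↑c [])) i []) [1, 0, 2, 0, 0]) (dotL (getL (raysOf RAYS_S2 (getL CONES_S2 ↑c [])) i []) [0, 3, 0, 0, 0]))) ∧
        dotL (getL (raysOf RAYS_S2 (getL CONES_S2 ↑c [])) i []) [1, 0, 2, 0, 0] - min (dotL (getL (raysOf RAYS_S2 (getL CONES_S2 ↑c [])) i []) [1, 0, 2, 0, 0]) (dotL (getL (raysOf RAYS_S2 (getL CONES_S2 ↑c [])) i []) [0, 3, 0, 0, 0]) -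
              (dotL (getL (raysOf RAYS_S2 (getL CONES_S2 ↑c [])) i []) [0, 3, 0, 0, 0] - min (dotL (getL (raysOf RAYS_S2 (getL CONES_S2 ↑c [])) i []) [1, 0, 2, 0, 0]) (dotL (getL (raysOf RAYS_S2 (getL CONES_S2 ↑c [])) i []) [0, 3, 0, 0, 0])) +
            (dotL (getL (raysOf RAYS_S2 (getL CONES_S2 ↑c [])) i []) [0, 3, 0, 0, 0] - min (dotL (getL (raysOf RAYS_S2 (getL CONES_S2 ↑c [])) i []) [1, 0, 2, 0, 0]) (dotL (getL (raysOf RAYS_S2 (getL CONES_S2 ↑c [])) i []) [0, 3, 0, 0, 0]) -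
              (dotL (getL (raysOf RAYS_S2 (getL CONES_S2 ↑c [])) i []) [1, 0, 2, 0, 0] - min (dotL (getL (raysOf RAYS_S2 (getL CONES_S2 ↑c [])) i []) [1, 0, 2, 0, 0]) (dotL (getL (raysOf RAYS_S2 (getL CONES_S2 ↑c [])) i []) [0, 3, 0, 0, 0]))) ≤ 4) →
      ∃ i, i ∉ Z ∧ (r i : k) ≠ (sx i : k) := by
    rintro ⟨i, hi5, hiZ, hd1, hd4⟩
    refine ⟨⟨i, hi5⟩, fun hz => hiZ ((hzi ⟨i, hi5⟩).mp hz), ?_⟩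
    have e1 := dA ⟨i, hi5⟩; have e2 := dB ⟨i, hi5⟩
    rw [e1, e2] at hd1 hd4
    rw [hr, hs]
    exact natCast_ne_of_dist p h2 h3 _ _ hd1 hd4
  rcases hsem with ⟨-, h0⟩ | ⟨-, hnd, hnpd, hle⟩ | ⟨-, hnd, hnpd, hle⟩ | ⟨-, hnd, hnpd, hle1, hle2⟩ | ⟨ht4, hdp, hle⟩ | ⟨-, hdp, hle, hwit⟩ | h6
  · -- tag 0 contradicts `M₁|Z ≠ 0`
    have := toZ _ h0 i₀ hi₀Z
    rw [dC, dA, dB, ← hM1] at this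
    exact absurd this hi₀
  · -- tag 1
    have hnd' : ¬ ((∃ i ∈ Z, r i ≠ 0) ∧ (∃ i ∈ Z, sx i ≠ 0)) := fun ⟨⟨i, hi, hri⟩, ⟨j, hj, hsj⟩⟩ =>
      hnd ⟨⟨i, (hzi i).mp hi, by rw [dA, dB, ← hr]; exact Nat.pos_of_ne_zero hri⟩, ⟨j, (hzi j).mp hj, by rw [dA, dB, ← hs]; exact Nat.pos_of_ne_zero hsj⟩⟩
    refine main (fun hr0 hs0 => ?_) (Or.inl ⟨hnd', Or.inl fun i hi => by have := toZ _ hle i hi; rwa [dC, dA, dB, ← hM2] at this⟩)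
    rcases hnpd with h | h | h
    · obtain ⟨i, hi, hP⟩ := toZ' _ h; rw [dA, dB, ← hr, hr0 i hi] at hP; exact absurd hP (lt_irrefl 0)
    · obtain ⟨i, hi, hP⟩ := toZ' _ h; rw [dA, dB, ← hs, hs0 i hi] at hP; exact absurd hP (lt_irrefl 0)
    · exact hT1np h
  · -- tag 2
    have hnd' : ¬ ((∃ i ∈ Z, r i ≠ 0) ∧ (∃ i ∈ Z, sx i ≠ 0)) := fun ⟨⟨i, hi, hri⟩, ⟨j, hj, hsj⟩⟩ =>
      hnd ⟨⟨i, (hzi i).mp hi, by rw [dA, dB, ← hr]; exact Nat.pos_of_ne_zero hri⟩, ⟨j, (hzi j).mp hj, by rw [dA, dB, ← hs]; exact Nat.pos_of_ne_zero hsj⟩⟩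
    refine main (fun hr0 hs0 => ?_) (Or.inl ⟨hnd', Or.inr (Or.inl fun i hi => by have := toZ _ hle i hi; rwa [dC, dA, dB, ← hM1] at this)⟩)
    rcases hnpd with h | h | h
    · obtain ⟨i, hi, hP⟩ := toZ' _ h; rw [dA, dB, ← hr, hr0 i hi] at hP; exact absurd hP (lt_irrefl 0)
    · obtain ⟨i, hi, hP⟩ := toZ' _ h; rw [dA, dB, ← hs, hs0 i hi] at hP; exact absurd hP (lt_irrefl 0)
    · exact hT1np h
  · -- tag 3
    have hnd' : ¬ ((∃ i ∈ Z, r i ≠ 0) ∧ (∃ i ∈ Z, sx i ≠ 0)) := fun ⟨⟨i, hi, hri⟩, ⟨j, hj, hsj⟩⟩ =>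
      hnd ⟨⟨i, (hzi i).mp hi, by rw [dA, dB, ← hr]; exact Nat.pos_of_ne_zero hri⟩, ⟨j, (hzi j).mp hj, by rw [dA, dB, ← hs]; exact Nat.pos_of_ne_zero hsj⟩⟩
    refine main (fun hr0 hs0 => ?_) (Or.inl ⟨hnd', Or.inr (Or.inr ⟨fun i hi => by have := toZ _ hle1 i hi; rwa [dC, dA, dB, ← hM1] at this,
      fun i hi => by have := toZ _ hle2 i hi; rwa [dC, dA, dB, ← hM2] at this, hp2⟩)⟩)
    rcases hnpd with h | h | h
    · obtain ⟨i, hi, hP⟩ := toZ' _ h; rw [dA, dB, ← hr, hr0 i hi] at hP; exact absurd hP (lt_irrefl 0)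
    · obtain ⟨i, hi, hP⟩ := toZ' _ h; rw [dA, dB, ← hs, hs0 i hi] at hP; exact absurd hP (lt_irrefl 0)
    · exact hT1np h
  · -- tag 4 (deep: the T1 provider is vacuous); side letters from the certificate
    have hdeep : (∃ i ∈ Z, r i ≠ 0) ∧ (∃ i ∈ Z, sx i ≠ 0) := by
      obtain ⟨i', hi', hP⟩ := toZ' _ hdp.1
      obtain ⟨j', hj', hQ⟩ := toZ' _ hdp.2
      rw [dA, dB, ← hr] at hP; rw [dA, dB, ← hs] at hQ
      exact ⟨⟨i', hi', Nat.pos_iff_ne_zero.mp hP⟩, ⟨j', hj', Nat.pos_iff_ne_zero.mp hQ⟩⟩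
    obtain ⟨⟨i', hi', hP, hQ⟩, ⟨j', hj', hP', hQ'⟩⟩ := tag4_side c zi ht4
    rw [← hCv, ← hAv, ← hBv] at hP hQ hP' hQ'
    obtain ⟨i₁, hi₁, hri₁⟩ := hdeep.1
    refine main (fun hr0 _ => absurd (hr0 i₁ hi₁) hri₁) (Or.inr ⟨hdeep, Or.inl ⟨fun i hi => by have := toZ _ hle i hi; rwa [dC, dA, dB, ← hM1] at this, ?_, ?_⟩⟩)
    · exact ⟨i', (hzi i').mpr hi', by rw [hM2, hr]; exact hP, by rw [hM1]; exact hQ⟩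
    · exact ⟨j', (hzi j').mpr hj', by rw [hM2, hs]; exact hP', by rw [hM1]; exact hQ'⟩
  · -- tag 5
    have hdeep : (∃ i ∈ Z, r i ≠ 0) ∧ (∃ i ∈ Z, sx i ≠ 0) := by
      obtain ⟨i', hi', hP⟩ := toZ' _ hdp.1
      obtain ⟨j', hj', hQ⟩ := toZ' _ hdp.2
      rw [dA, dB, ← hr] at hP; rw [dA, dB, ← hs] at hQ
      exact ⟨⟨i', hi', Nat.pos_iff_ne_zero.mp hP⟩, ⟨j', hj', Nat.pos_iff_ne_zero.mp hQ⟩⟩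
    obtain ⟨i₁, hi₁, hri₁⟩ := hdeep.1
    refine main (fun hr0 _ => absurd (hr0 i₁ hi₁) hri₁) (Or.inr ⟨hdeep, Or.inr ⟨fun i hi => by have := toZ _ hle i hi; rwa [dC, dA, dB, ← hM2, ← hr] at this, ?_⟩⟩)
    obtain ⟨i', hi', hP⟩ := toZ' _ hwit
    rw [dC, dA, dB, ← hM1, ← hr] at hP
    exact ⟨i', hi', Nat.pos_iff_ne_zero.mp hP.1, hP.2⟩
  · -- tags ≥ 6 do not occur
    exfalso
    obtain ⟨_, _, _, _, _, _, _, _, _, hTl, hT31, hT5, _⟩ := ExitTagSemantics.shapes_S2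
    rw [List.all_eq_true] at hT5
    have h := hT5 (getL TAGS_S2 c []) (getL_mem TAGS_S2 c [] (by rw [hTl]; exact c.2))
    rw [List.all_eq_true] at h
    have htlen : (getL TAGS_S2 c []).length = 31 := ExitTagSemantics.length_of_allLen hT31 _ (getL_mem TAGS_S2 c [] (by rw [hTl]; exact c.2))
    have h' := h (getL (getL TAGS_S2 c []) zi 9) (getL_mem (getL TAGS_S2 c []) zi 9 (by rw [htlen]; exact zi.2))
    simp only [Bool.or_eq_true, Nat.ble_eq, Nat.beq_eq] at h'
    rcases h' with h' | h'
    · omega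
    · rw [h'] at hok
      simp [OmegaOneCureFanCertStrong.exitOKW', OmegaOneCureFanCertStrong.exitOKW] at hok

/-- ★★★ **THE Ω₁ ROW INPUT `hrow`: `Bl_{(L³+(ḡ)L²)·K″} X_{B9}` IS `FullCl p` AT EVERY POINT** (`k = k̄` of characteristic `p`, `2·3·31 ≠ 0` in `k`). Closed points by
`fullCl_stalk_cure_b9_of_isClosed`; all points by ✓ `ClauseLocalizes.fiClause_of_closedPoints` (the blow-up is of finite type over `k`). [OURS · F6 assembly] -/
theorem fullCl_stalk_cure_b9 (p : ℕ) [Fact p.Prime] (k : Type) [Field k] [IsAlgClosed k] [CharP k p] (h2 : (2 : k) ≠ 0) (h3 : (3 : k) ≠ 0) (h31 : (31 : k) ≠ 0)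
    (f : MvPolynomial (Fin 5) k) (hf : f = X 4 ^ 2 + X 0 ^ 9 + X 1 ^ 9 + X 2 ^ 9 + X 3 ^ 9) :
    ∀ y : ↥(affineBlowup ((Ideal.span ((fun e : Fin 5 →₀ ℕ => Ideal.Quotient.mk (Ideal.span {f}) (monomial e (1 : k))) '' (genSet 5 B9NewtonKFan.AL2 : Set (Fin 5 →₀ ℕ))) ^ 3 +
        Ideal.span {Ideal.Quotient.mk (Ideal.span {f}) (X 0 * X 2 ^ 2 - X 1 ^ 3)} *
          Ideal.span ((fun e : Fin 5 →₀ ℕ => Ideal.Quotient.mk (Ideal.span {f}) (monomial e (1 : k))) '' (genSet 5 B9NewtonKFan.AL2 : Set (Fin 5 →₀ ℕ))) ^ 2) *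
        Ideal.span ((fun e : Fin 5 →₀ ℕ => Ideal.Quotient.mk (Ideal.span {f}) (monomial e (1 : k))) '' (genSet 5 AL2 : Set (Fin 5 →₀ ℕ))))),
      FullCl p ((affineBlowup ((Ideal.span ((fun e : Fin 5 →₀ ℕ => Ideal.Quotient.mk (Ideal.span {f}) (monomial e (1 : k))) '' (genSet 5 B9NewtonKFan.AL2 : Set (Fin 5 →₀ ℕ))) ^ 3 +
        Ideal.span {Ideal.Quotient.mk (Ideal.span {f}) (X 0 * X 2 ^ 2 - X 1 ^ 3)} *
          Ideal.span ((fun e : Fin 5 →₀ ℕ => Ideal.Quotient.mk (Ideal.span {f}) (monomial e (1 : k))) '' (genSet 5 B9NewtonKFan.AL2 : Set (Fin 5 →₀ ℕ))) ^ 2) *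
        Ideal.span ((fun e : Fin 5 →₀ ℕ => Ideal.Quotient.mk (Ideal.span {f}) (monomial e (1 : k))) '' (genSet 5 AL2 : Set (Fin 5 →₀ ℕ))))).presheaf.stalk y) := by
  set R := MvPolynomial (Fin 5) k ⧸ Ideal.span {f} with hR
  set J : Ideal R := (Ideal.span ((fun e : Fin 5 →₀ ℕ => Ideal.Quotient.mk (Ideal.span {f}) (monomial e (1 : k))) '' (genSet 5 B9NewtonKFan.AL2 : Set (Fin 5 →₀ ℕ))) ^ 3 +
        Ideal.span {Ideal.Quotient.mk (Ideal.span {f}) (X 0 * X 2 ^ 2 - X 1 ^ 3)} *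
          Ideal.span ((fun e : Fin 5 →₀ ℕ => Ideal.Quotient.mk (Ideal.span {f}) (monomial e (1 : k))) '' (genSet 5 B9NewtonKFan.AL2 : Set (Fin 5 →₀ ℕ))) ^ 2) *
        Ideal.span ((fun e : Fin 5 →₀ ℕ => Ideal.Quotient.mk (Ideal.span {f}) (monomial e (1 : k))) '' (genSet 5 AL2 : Set (Fin 5 →₀ ℕ))) with hJ
  haveI : Algebra.FiniteType k R := Algebra.FiniteType.of_surjective (Ideal.Quotient.mkₐ k (Ideal.span {f})) (Ideal.Quotient.mkₐ_surjective k _)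
  let b : Spec (.of R) ⟶ Spec (.of k) := Spec.map (CommRingCat.ofHom (algebraMap k R))
  haveI : LocallyOfFiniteType b := by
    rw [HasRingHomProperty.Spec_iff (P := @LocallyOfFiniteType)]
    exact RingHom.finiteType_algebraMap.mpr inferInstance
  haveI : LocallyOfFiniteType (affineBlowup.π J ≫ b) := inferInstance
  exact ClauseLocalizes.fiClause_of_closedPoints (Fact.out : p.Prime) (affineBlowup.π J ≫ b)
    (fun y hy => fullCl_stalk_cure_b9_of_isClosed p k h2 h3 h31 f hf y hy)

/-- ★★★ **THE Ω₁ ROW, CURED: the F-half's conclusion at the vertex of B9 for the Ω₁ floor** `(L³+(ḡ)L²)·𝒪_{X,v}`: for EVERY blowing up `g : S′ → Spec 𝒪_{X,v}` along it there is `𝓚 ≠ ⊥` on `S′`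
over the closed point ALL of whose blowings up are FULL at every stalk (✓ `FHalfRowOfProductCentre.fHalfConclusion_of_affineBlowup_mul` on `fullCl_stalk_cure_b9`; `𝔪_v ⊆ √K″` from the five pure powers).
[OURS · F7 line; cite: StacksProject, Tag 080A; GortzWedhorn2020, Prop. 13.92] -/
theorem omega1_floor_cured_b9 (p : ℕ) [Fact p.Prime] (k : Type) [Field k] [IsAlgClosed k] [CharP k p] (h2 : (2 : k) ≠ 0) (h3 : (3 : k) ≠ 0) (h31 : (31 : k) ≠ 0)
    (f : MvPolynomial (Fin 5) k) (hf : f = X 4 ^ 2 + X 0 ^ 9 + X 1 ^ 9 + X 2 ^ 9 + X 3 ^ 9)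
    (v : Spec (.of (MvPolynomial (Fin 5) k ⧸ Ideal.span {f})))
    (hvK : v.asIdeal ≤ (Ideal.span ((fun e : Fin 5 →₀ ℕ => Ideal.Quotient.mk (Ideal.span {f}) (monomial e (1 : k))) '' (genSet 5 AL2 : Set (Fin 5 →₀ ℕ)))).radical) :
    ∀ (S' : Scheme.{0}) (g : S' ⟶ Spec ((Spec (.of (MvPolynomial (Fin 5) k ⧸ Ideal.span {f}))).presheaf.stalk v)),
      IsBlowup g ((affineBlowup.idealSheaf (Ideal.span ((fun e : Fin 5 →₀ ℕ => Ideal.Quotient.mk (Ideal.span {f}) (monomial e (1 : k))) '' (genSet 5 B9NewtonKFan.AL2 : Set (Fin 5 →₀ ℕ))) ^ 3 +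
        Ideal.span {Ideal.Quotient.mk (Ideal.span {f}) (X 0 * X 2 ^ 2 - X 1 ^ 3)} *
          Ideal.span ((fun e : Fin 5 →₀ ℕ => Ideal.Quotient.mk (Ideal.span {f}) (monomial e (1 : k))) '' (genSet 5 B9NewtonKFan.AL2 : Set (Fin 5 →₀ ℕ))) ^ 2)).comap
          ((Spec (.of (MvPolynomial (Fin 5) k ⧸ Ideal.span {f}))).fromSpecStalk v)) →
      ∃ 𝓚 : S'.IdealSheafData, 𝓚 ≠ ⊥ ∧ (∀ s ∈ (𝓚.support : Set S'), g.base s = closedPoint _) ∧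
        ∀ (S'' : Scheme.{0}) (π : S'' ⟶ S'), IsBlowup π 𝓚 → ∀ s : S'', FullCl p (S''.presheaf.stalk s) := by
  classical
  haveI hpr : (Ideal.span {f}).IsPrime := (Ideal.span_singleton_prime (B9Specimen.prime_f k h3 f hf).ne_zero).mpr (B9Specimen.prime_f k h3 f hf)
  haveI : IsDomain (MvPolynomial (Fin 5) k ⧸ Ideal.span {f}) := Ideal.Quotient.isDomain _
  have hXne := B9Specimen.mk_X_ne_zero k h3 f hf
  have hmono : ∀ e : Fin 5 →₀ ℕ, Ideal.Quotient.mk (Ideal.span {f}) (monomial e (1 : k)) ≠ 0 := fun e => by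
    rw [monomial_eq, C_1, one_mul, Finsupp.prod, map_prod]
    exact Finset.prod_ne_zero_iff.mpr fun j _ => by rw [map_pow]; exact pow_ne_zero _ (hXne j)
  have hLne : Ideal.span ((fun e : Fin 5 →₀ ℕ => Ideal.Quotient.mk (Ideal.span {f}) (monomial e (1 : k))) '' (genSet 5 B9NewtonKFan.AL2 : Set (Fin 5 →₀ ℕ))) ≠ ⊥ := fun h0 =>
    hmono _ (by rw [← Ideal.mem_bot, ← h0]; exact B9NewtonKFan.hv k _ 0)
  have hKne : Ideal.span ((fun e : Fin 5 →₀ ℕ => Ideal.Quotient.mk (Ideal.span {f}) (monomial e (1 : k))) '' (genSet 5 AL2 : Set (Fin 5 →₀ ℕ))) ≠ ⊥ := fun h0 =>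
    hmono _ (by rw [← Ideal.mem_bot, ← h0]; exact hv k _ 0)
  have hτne : Ideal.span ((fun e : Fin 5 →₀ ℕ => Ideal.Quotient.mk (Ideal.span {f}) (monomial e (1 : k))) '' (genSet 5 B9NewtonKFan.AL2 : Set (Fin 5 →₀ ℕ))) ^ 3 +
        Ideal.span {Ideal.Quotient.mk (Ideal.span {f}) (X 0 * X 2 ^ 2 - X 1 ^ 3)} *
          Ideal.span ((fun e : Fin 5 →₀ ℕ => Ideal.Quotient.mk (Ideal.span {f}) (monomial e (1 : k))) '' (genSet 5 B9NewtonKFan.AL2 : Set (Fin 5 →₀ ℕ))) ^ 2 ≠ ⊥ := by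
    intro h0
    have h3ne : Ideal.span ((fun e : Fin 5 →₀ ℕ => Ideal.Quotient.mk (Ideal.span {f}) (monomial e (1 : k))) '' (genSet 5 B9NewtonKFan.AL2 : Set (Fin 5 →₀ ℕ))) ^ 3 ≠ ⊥ := by
      rw [pow_succ, pow_two]
      simp only [Ne, Ideal.mul_eq_bot, hLne, or_self, not_false_eq_true]
    exact h3ne (le_bot_iff.mp (le_trans le_sup_left (le_of_eq h0)))
  exact FHalfRowOfProductCentre.fHalfConclusion_of_affineBlowup_mul p _ _ hτne hKne v hvK (fullCl_stalk_cure_b9 p k h2 h3 h31 f hf)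

end Summit.ResolutionOfSingularities.ResolutionOfSingularities.Theorems.FInjectiveMacaulayfication.OmegaOneS2PencilRow

end
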